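import Literature.MeasureTheory.Integral.PushforwardDensityGluing

/-!
# CHART TRANSPORT OF THE LOCAL JACOBIAN FACE — a push-forward density statement for the chart-read map between the
# flat models becomes the same statement for the map between the curved spaces ([HormanderALPDO1] §6.1, proof of
# Thm 6.1.2: «in local coordinates … f is the projection»; bookkeeping)

Generic measure theory; every declaration is a THEOREM proved here from Mathlib (no `def`, no named fact, no `sorry`).
LOCATED CONSUMER (cell `pub-ymgap`, YM-PLAN Track A, node N09 [B12] width seat `pub-ymgap-dag-n09-w2` g4, `--supports` K1⁷
`StabilityBAtRecordR13SepCoPH` = stmt-QuantumFields-20542, count-neutral helper): node00-def-K0e's located debt (F1) «the Jacobian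
face of [Balaban1987RG1] (0.4)'s disintegration».  The LOCAL ROUTE to the analytic inclusion `hreg` now reads, by name:
flat local engines (`SubmersionPushforward…` p610570 ∕ `AnalyticSubmersion…` p613264, on finite-dimensional real spaces)
→ **THIS FILE** (the engine's conclusion for the chart-read map `e ↦ ΛY (M (ΘX e))` at `e₀` becomes the local face of `M`
itself at `a = ΘX e₀`, w.r.t. the curved measures `ν`, `μG`) → `PushforwardDensityGluing.exists_continuous_density_of_locally'`
(p615697: per-point faces at every point of a compact set glue to ONE density continuous on the whole target) →
`PushforwardDensityGluing.integral_mul_comp_eq_integral_mul_of_forall_preimage` (the (0.13) test identity) → the record's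
continuous-candidate door `Node00.RegSetOfFibredChart.subset_regSetOfRecord_of_forall_integral_eq`.

THE CHART DATA ARE DISPLAYED HYPOTHESES (nothing is instantiated here; `X`, `E`, `Y` carry `OpensMeasurableSpace` structures, the
target `G` any topology and σ-algebra):
* source chart `ΘX : E → X`, measurable, continuous + injective + open on an open `T ⊆ E`, an inner open `T₀ ∋ e₀` with
  `closure T₀ ⊆ T`, a Jacobian `JX ≥ 0` (measurable, continuous and bounded on `T`) and the change of variables
  `ν⌊(ΘX '' T) = ΘX_*((JX)·μE⌊T)`;
* target chart `ΘY : Y → G`, measurable, injective + open on an open `S ⊆ Y`, with a measurable inverse `ΛY : G → Y`,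
  continuous on `ΘY '' S`, `ΛY (ΘY u) = u` on `S`, a Jacobian `JY ≥ 0` (measurable, continuous and POSITIVE on `S`) and
  `μG⌊(ΘY '' S) = ΘY_*((JY)·μY⌊S)`;
* the map `M : X → G` measurable, continuous at `a = ΘX e₀`, chart-readable on `T₀` (`M (ΘX e) ∈ ΘY '' S`).
At the record these are the translated exponential windows of lit-balaban p28 and dag-n09-w4 g4's
`HaarExpChartChangeOfVariables(Pi)(Measure)` ∕ `FieldMeasureExpChartChangeOfVariables` identities (scalar `σ₀^{|B|}` folded
into `J`) — consumed here only as hypotheses of this SHAPE.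

WHAT IS PROVED (namespace `Literature.MeasureTheory.Integral.PushforwardDensityChartTransport`).
* `measurable_indicator_of_continuousOn` — `D.indicator I` is measurable for `I` continuous on a measurable `D`.
* ★★★ **`localFace_of_chartRead`** — from the FLAT local face of the chart-read map at `e₀` (engine form: every measurable
  bounded `r̃ ≥ 0` on `E` vanishing off the window `O` and continuous at each `e ∈ O` with `Q (ΘX e)` has above `D` a density
  of its push-forward continuous on `D`) to the local face of `M` at `a` in the SHARP form of p615697 (windows
  `ΘX '' (O ∩ T₀)` and `ΘY '' (D ∩ S)`): for `r` on `X` pull back `r̃ := 𝟙_T · (r ∘ ΘX) · JX`, read the flat density `I`, and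
  push `y ↦ I(ΛY y) ∕ JY(ΛY y)`; the two cov identities and `Measure.restrict_restrict` ∕ `setLIntegral_map` ∕
  `setLIntegral_withDensity_eq_setLIntegral_mul` do the bookkeeping; the sharp-form continuity hypothesis on `r` (continuity at
  every point off the exempt part of the window) is what makes `r̃` continuous across `∂T₀` and `∂T`.

HONEST SCOPE.  Bookkeeping only: no chart is constructed, no Jacobian computed, no claim about Bałaban's averaging (the record
inputs — the chart-read block averaging is an analytic submersion on the guard; transversality of the thresholds; N07's
continuity — stay located-open), about N09, or about the Clay problem.
-/

noncomputable section

namespace Literature.MeasureTheory.Integral.PushforwardDensityChartTransport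

open _root_.MeasureTheory _root_.MeasureTheory.Measure Set Function Filter
open scoped ENNReal NNReal Topology

/-! ## §1 A measurability helper -/

section Helper

variable {Y : Type*} [TopologicalSpace Y] [MeasurableSpace Y] [OpensMeasurableSpace Y]

/-- A function continuous on a measurable set `D`, extended by zero off `D`, is measurable (restriction to `D` is continuous,
restriction to `Dᶜ` is constant). [cite: HormanderALPDO1, §6.1 (bookkeeping)] -/
theorem measurable_indicator_of_continuousOn {D : Set Y} (hD : MeasurableSet D) {I : Y → ℝ} (hI : ContinuousOn I D) :
    Measurable (D.indicator I) := by
  refine measurable_of_restrict_of_restrict_compl hD ?_ ?_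
  · have h1 : D.restrict (D.indicator I) = D.restrict I := by
      funext u
      exact indicator_of_mem u.2 _
    rw [h1]
    exact (continuousOn_iff_continuous_restrict.1 hI).measurable
  · have h2 : Dᶜ.restrict (D.indicator I) = fun _ => 0 := by
      funext u
      exact indicator_of_notMem u.2 _
    rw [h2]
    exact measurable_const

end Helper

/-! ## §2 The chart transport -/

section Transport

variable {E : Type*} [TopologicalSpace E] [MeasurableSpace E] [OpensMeasurableSpace E]
  {Y : Type*} [TopologicalSpace Y] [MeasurableSpace Y] [OpensMeasurableSpace Y]
  {X : Type*} [TopologicalSpace X] [MeasurableSpace X] [OpensMeasurableSpace X]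
  {G : Type*} [TopologicalSpace G] [MeasurableSpace G]

/-- ★★★ **CHART TRANSPORT OF THE LOCAL JACOBIAN FACE.**  See the module docstring for the displayed chart data.  If the
chart-read map `e ↦ ΛY (M (ΘX e))` carries at `e₀` the FLAT local face (engine form, exemption `Q ∘ ΘX`) w.r.t. `μE`, `μY` —
the conclusion shape of `SubmersionPushforward.exists_continuousOn_density_map_of_submersion` and of
`AnalyticSubmersion.exists_continuousOn_density_map_of_analytic_submersion_sharp` — then `M` carries at `a = ΘX e₀` the local
face w.r.t. `ν`, `μG` in the SHARP form, i.e. VERBATIM the per-point clause `hloc` of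
`PushforwardDensityGluing.exists_continuous_density_of_locally'`: windows `ΘX '' (O ∩ T₀) ∋ a` and `ΘY '' (D ∩ S) ∋ M a`, and
for every measurable bounded `r ≥ 0` on `X` vanishing off the source window and continuous at every point off its exempt part
a density `y ↦ I(ΛY y) ∕ JY(ΛY y)` of `M_*(r·ν)` w.r.t. `μG`, continuous on the target window.
[cite: HormanderALPDO1, §6.1, proof of Thm 6.1.2 (local coordinates in which the submersion is read; bookkeeping)] -/
theorem localFace_of_chartRead (μE : Measure E) (μY : Measure Y) (ν : Measure X) (μG : Measure G)
    -- source chart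
    {ΘX : E → X} (hΘXm : Measurable ΘX) {T T₀ : Set E} (hT : IsOpen T) (hT₀ : IsOpen T₀) (hT₀T : closure T₀ ⊆ T)
    (hΘXc : ContinuousOn ΘX T) (hΘXi : InjOn ΘX T) (hΘXo : ∀ V : Set E, V ⊆ T → IsOpen V → IsOpen (ΘX '' V))
    {JX : E → ℝ} (hJXm : Measurable JX) (hJXc : ContinuousOn JX T) (hJX0 : ∀ e, 0 ≤ JX e)
    (hJXC : ∃ C : ℝ, ∀ e ∈ T, JX e ≤ C)
    (hcovX : ν.restrict (ΘX '' T) = ((μE.restrict T).withDensity fun e => ENNReal.ofReal (JX e)).map ΘX)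
    -- target chart
    {ΘY : Y → G} (hΘYm : Measurable ΘY) {S : Set Y} (hS : IsOpen S) (hΘYi : InjOn ΘY S)
    (hΘYo : ∀ V : Set Y, V ⊆ S → IsOpen V → IsOpen (ΘY '' V)) {ΛY : G → Y} (hΛYm : Measurable ΛY)
    (hΛYc : ContinuousOn ΛY (ΘY '' S)) (hΛΘ : ∀ u ∈ S, ΛY (ΘY u) = u)
    {JY : Y → ℝ} (hJYm : Measurable JY) (hJYc : ContinuousOn JY S) (hJY0 : ∀ u, 0 ≤ JY u)
    (hJYpos : ∀ u ∈ S, 0 < JY u)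
    (hcovY : μG.restrict (ΘY '' S) = ((μY.restrict S).withDensity fun u => ENNReal.ofReal (JY u)).map ΘY)
    -- the map, the base point, chart-readability
    {M : X → G} (hMm : Measurable M) {e₀ : E} (he₀ : e₀ ∈ T₀) {a : X} (ha : ΘX e₀ = a) (hMc : ContinuousAt M a)
    (hread : ∀ e ∈ T₀, M (ΘX e) ∈ ΘY '' S) (Q : X → Prop)
    -- the flat local face of the chart-read map at `e₀` (engine form)
    (hflat : ∃ O : Set E, ∃ D : Set Y, IsOpen O ∧ e₀ ∈ O ∧ IsOpen D ∧ ΛY (M (ΘX e₀)) ∈ D ∧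
      ∀ r : E → ℝ, Measurable r → (∀ e, 0 ≤ r e) → (∀ e ∈ O, Q (ΘX e) → ContinuousAt r e) →
        (∃ C : ℝ, ∀ e, r e ≤ C) → (∀ e, e ∉ O → r e = 0) →
        ∃ I : Y → ℝ, ContinuousOn I D ∧ (∀ w, 0 ≤ I w) ∧ ∀ A : Set Y, MeasurableSet A → A ⊆ D →
          (μE.withDensity fun e => ENNReal.ofReal (r e)) ((fun e => ΛY (M (ΘX e))) ⁻¹' A) =
            ∫⁻ w in A, ENNReal.ofReal (I w) ∂μY) :
    ∃ W : Set X, ∃ DG : Set G, ContinuousAt M a ∧ IsOpen W ∧ a ∈ W ∧ IsOpen DG ∧ M a ∈ DG ∧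
      ∀ r : X → ℝ, Measurable r → (∀ x, 0 ≤ r x) → (∀ x, (x ∈ W → Q x) → ContinuousAt r x) →
        (∃ C : ℝ, ∀ x, r x ≤ C) → (∀ x, x ∉ W → r x = 0) →
        ∃ I : G → ℝ, ContinuousOn I DG ∧ (∀ y, 0 ≤ I y) ∧ ∀ B : Set G, MeasurableSet B → B ⊆ DG →
          (ν.withDensity fun x => ENNReal.ofReal (r x)) (M ⁻¹' B) = ∫⁻ y in B, ENNReal.ofReal (I y) ∂μG := by
  subst ha
  obtain ⟨O, D, hO, he₀O, hD, hm₀D, hH⟩ := hflat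
  have hT₀T' : T₀ ⊆ T := subset_closure.trans hT₀T
  have hWT : ΘX '' (O ∩ T₀) ⊆ ΘX '' T := image_mono (inter_subset_right.trans hT₀T')
  -- `M a` lies in the target window
  have hMa : M (ΘX e₀) ∈ ΘY '' (D ∩ S) := by
    obtain ⟨u, huS, hu⟩ := hread e₀ he₀
    refine ⟨u, ⟨?_, huS⟩, hu⟩
    have h1 : ΛY (M (ΘX e₀)) = u := by rw [← hu, hΛΘ u huS]
    rw [← h1]
    exact hm₀D
  refine ⟨ΘX '' (O ∩ T₀), ΘY '' (D ∩ S), hMc, hΘXo _ (inter_subset_right.trans hT₀T') (hO.inter hT₀),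
    ⟨e₀, ⟨he₀O, he₀⟩, rfl⟩, hΘYo _ inter_subset_right (hD.inter hS), hMa, ?_⟩
  intro r hrm hr0 hrc hrC hrW
  -- where `r ∘ ΘX` does not vanish on `T`
  have hkey : ∀ e ∈ T, r (ΘX e) ≠ 0 → e ∈ O ∩ T₀ := by
    intro e he hne
    by_contra hcon
    apply hne
    apply hrW
    rintro ⟨e', he', hee'⟩
    have h1 : e' = e := hΘXi (hT₀T' he'.2) he hee'
    exact hcon (h1 ▸ he')
  -- the pulled-back density `r̃ = 𝟙_T · (r ∘ ΘX) · JX`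
  set rt : E → ℝ := T.indicator fun e => r (ΘX e) * JX e with hrt
  have hrtm : Measurable rt := ((hrm.comp hΘXm).mul hJXm).indicator hT.measurableSet
  have hrt0 : ∀ e, 0 ≤ rt e := fun e => indicator_nonneg (fun e _ => mul_nonneg (hr0 _) (hJX0 e)) e
  obtain ⟨C, hC⟩ := hrC
  obtain ⟨CJ, hCJ⟩ := hJXC
  have hC0 : 0 ≤ C := (hr0 (ΘX e₀)).trans (hC _)
  have hCJ0 : 0 ≤ CJ := (hJX0 e₀).trans (hCJ e₀ (hT₀T' he₀))
  have hrtC : ∃ C' : ℝ, ∀ e, rt e ≤ C' := by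
    refine ⟨C * CJ, fun e => ?_⟩
    by_cases he : e ∈ T
    · rw [hrt, indicator_of_mem he]
      exact mul_le_mul (hC _) (hCJ e he) (hJX0 e) hC0
    · rw [hrt, indicator_of_notMem he]
      exact mul_nonneg hC0 hCJ0
  have hrtO : ∀ e, e ∉ O → rt e = 0 := by
    intro e heO
    by_cases he : e ∈ T
    · rw [hrt, indicator_of_mem he]
      have h1 : r (ΘX e) = 0 := by
        by_contra hne
        exact heO (hkey e he hne).1
      simp [h1]
    · exact indicator_of_notMem he _
  have hrt_far : ∀ e, e ∉ T → rt =ᶠ[𝓝 e] fun _ => (0 : ℝ) := by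
    intro e he
    have he' : e ∉ closure T₀ := fun h => he (hT₀T h)
    filter_upwards [isClosed_closure.isOpen_compl.mem_nhds he'] with e'' he''
    by_cases he''T : e'' ∈ T
    · rw [hrt, indicator_of_mem he''T]
      have h1 : r (ΘX e'') = 0 := by
        by_contra hne
        exact he'' (subset_closure (hkey e'' he''T hne).2)
      simp [h1]
    · exact indicator_of_notMem he''T _
  have hrtc : ∀ e ∈ O, Q (ΘX e) → ContinuousAt rt e := by
    intro e _ hQ
    by_cases he : e ∈ T
    · have h1 : rt =ᶠ[𝓝 e] fun e => r (ΘX e) * JX e := by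
        filter_upwards [hT.mem_nhds he] with e' he' using indicator_of_mem he' _
      refine (continuousAt_congr h1).2 ?_
      have hrx : ContinuousAt r (ΘX e) := hrc _ fun _ => hQ
      have h2 : ContinuousAt (fun e => r (ΘX e)) e := hrx.comp (hΘXc.continuousAt (hT.mem_nhds he))
      exact h2.mul (hJXc.continuousAt (hT.mem_nhds he))
    · exact (continuousAt_congr (hrt_far e he)).2 continuousAt_const
  -- the flat face, with the density upgraded to a measurable one
  obtain ⟨I₀, hI₀c, hI₀0, hI₀A⟩ := hH rt hrtm hrt0 hrtc hrtC hrtO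
  set I : Y → ℝ := D.indicator I₀ with hI
  have hIm : Measurable I := measurable_indicator_of_continuousOn hD.measurableSet hI₀c
  have hIc : ContinuousOn I D := hI₀c.congr fun u hu => indicator_of_mem hu _
  have hI0 : ∀ u, 0 ≤ I u := fun u => indicator_nonneg (fun u _ => hI₀0 u) u
  have hIA : ∀ A : Set Y, MeasurableSet A → A ⊆ D →
      (μE.withDensity fun e => ENNReal.ofReal (rt e)) ((fun e => ΛY (M (ΘX e))) ⁻¹' A) =
        ∫⁻ w in A, ENNReal.ofReal (I w) ∂μY := by
    intro A hA hAD
    rw [hI₀A A hA hAD]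
    exact setLIntegral_congr_fun hA fun w hw => by rw [hI, indicator_of_mem (hAD hw)]
  -- the transported density
  refine ⟨fun y => I (ΛY y) / JY (ΛY y), ?_, fun y => div_nonneg (hI0 _) (hJY0 _), fun B hB hBsub => ?_⟩
  · -- continuity on `ΘY '' (D ∩ S)`
    have hmaps : MapsTo ΛY (ΘY '' (D ∩ S)) (D ∩ S) := by
      rintro _ ⟨u, hu, rfl⟩
      rw [hΛΘ u hu.2]
      exact hu
    have hΛc : ContinuousOn ΛY (ΘY '' (D ∩ S)) := hΛYc.mono (image_mono inter_subset_right)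
    exact ((hIc.mono inter_subset_left).comp hΛc hmaps).div ((hJYc.mono inter_subset_right).comp hΛc hmaps)
      fun y hy => (hJYpos _ (hmaps hy).2).ne'
  -- the identity above `B ⊆ ΘY '' (D ∩ S)`
  have hBS : B ⊆ ΘY '' S := hBsub.trans (image_mono inter_subset_right)
  set A : Set Y := ΘY ⁻¹' B ∩ S with hAdef
  have hAm : MeasurableSet A := (hΘYm hB).inter hS.measurableSet
  have hAD : A ⊆ D := by
    rintro u ⟨huB, huS⟩
    obtain ⟨u', hu', he⟩ := hBsub huB
    rw [← hΘYi hu'.2 huS he]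
    exact hu'.1
  have hTm' : MeasurableSet (ΘX '' T) := (hΘXo T Subset.rfl hT).measurableSet
  -- (1) the curved left-hand side through the source chart
  have hL : (ν.withDensity fun x => ENNReal.ofReal (r x)) (M ⁻¹' B) =
      ∫⁻ e in (fun e => M (ΘX e)) ⁻¹' B ∩ T, ENNReal.ofReal (JX e) * ENNReal.ofReal (r (ΘX e)) ∂μE := by
    rw [withDensity_apply _ (hMm hB), ← lintegral_inter_add_sdiff _ (M ⁻¹' B) hTm']
    have hz : ∫⁻ x in M ⁻¹' B \ ΘX '' T, ENNReal.ofReal (r x) ∂ν = 0 := by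
      have h1 : EqOn (fun x => ENNReal.ofReal (r x)) (fun _ => 0) (M ⁻¹' B \ ΘX '' T) := by
        intro x hx
        have : r x = 0 := hrW x fun h => hx.2 (hWT h)
        simp [this]
      rw [setLIntegral_congr_fun ((hMm hB).diff hTm') h1, lintegral_zero]
    have hm1 : Measurable fun x => ENNReal.ofReal (r (ΘX x)) := (hrm.comp hΘXm).ennreal_ofReal
    rw [hz, add_zero, ← Measure.restrict_restrict (hMm hB), hcovX, setLIntegral_map (hMm hB) hrm.ennreal_ofReal hΘXm,
      setLIntegral_withDensity_eq_setLIntegral_mul _ hJXm.ennreal_ofReal hm1 (hΘXm (hMm hB)),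
      Measure.restrict_restrict (hΘXm (hMm hB))]
    rfl
  -- (2) the flat left-hand side
  have hpre : MeasurableSet ((fun e => ΛY (M (ΘX e))) ⁻¹' A) := (hΛYm.comp (hMm.comp hΘXm)) hAm
  have hF : (μE.withDensity fun e => ENNReal.ofReal (rt e)) ((fun e => ΛY (M (ΘX e))) ⁻¹' A) =
      ∫⁻ e in (fun e => ΛY (M (ΘX e))) ⁻¹' A ∩ T, ENNReal.ofReal (JX e) * ENNReal.ofReal (r (ΘX e)) ∂μE := by
    rw [withDensity_apply _ hpre, ← lintegral_inter_add_sdiff _ _ hT.measurableSet]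
    have hz : ∫⁻ e in (fun e => ΛY (M (ΘX e))) ⁻¹' A \ T, ENNReal.ofReal (rt e) ∂μE = 0 := by
      have h1 : EqOn (fun e => ENNReal.ofReal (rt e)) (fun _ => 0) ((fun e => ΛY (M (ΘX e))) ⁻¹' A \ T) := by
        intro e he
        simp [hrt, indicator_of_notMem he.2]
      rw [setLIntegral_congr_fun (hpre.diff hT.measurableSet) h1, lintegral_zero]
    rw [hz, add_zero]
    refine setLIntegral_congr_fun (hpre.inter hT.measurableSet) fun e he => ?_
    simp only [hrt, indicator_of_mem he.2]
    rw [ENNReal.ofReal_mul (hr0 _), mul_comm]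
  -- (3) the two flat integrals agree: on `T`, where `r ∘ ΘX ≠ 0`, membership in the two sets coincides
  have hLF : ∫⁻ e in (fun e => M (ΘX e)) ⁻¹' B ∩ T, ENNReal.ofReal (JX e) * ENNReal.ofReal (r (ΘX e)) ∂μE =
      ∫⁻ e in (fun e => ΛY (M (ΘX e))) ⁻¹' A ∩ T, ENNReal.ofReal (JX e) * ENNReal.ofReal (r (ΘX e)) ∂μE := by
    have hPm : MeasurableSet ((fun e => M (ΘX e)) ⁻¹' B) := (hMm.comp hΘXm) hB
    rw [← Measure.restrict_restrict hPm, ← Measure.restrict_restrict hpre, ← lintegral_indicator hPm,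
      ← lintegral_indicator hpre]
    refine setLIntegral_congr_fun hT.measurableSet fun e he => ?_
    by_cases hre : r (ΘX e) = 0
    · have h1 : ∀ P₁ : Set E, P₁.indicator (fun e => ENNReal.ofReal (JX e) * ENNReal.ofReal (r (ΘX e))) e = 0 := by
        intro P₁
        by_cases hP₁ : e ∈ P₁
        · rw [indicator_of_mem hP₁, hre, ENNReal.ofReal_zero, mul_zero]
        · rw [indicator_of_notMem hP₁]
      rw [h1, h1]
    · obtain ⟨u', hu'S, hu'⟩ := hread e (hkey e he hre).2
      have hiff : e ∈ (fun e => M (ΘX e)) ⁻¹' B ↔ e ∈ (fun e => ΛY (M (ΘX e))) ⁻¹' A := by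
        simp only [mem_preimage, hAdef, mem_inter_iff]
        rw [← hu', hΛΘ u' hu'S]
        exact ⟨fun h => ⟨h, hu'S⟩, fun h => h.1⟩
      by_cases hP : e ∈ (fun e => M (ΘX e)) ⁻¹' B
      · rw [indicator_of_mem hP, indicator_of_mem (hiff.1 hP)]
      · rw [indicator_of_notMem hP, indicator_of_notMem (fun h => hP (hiff.2 h))]
  -- (4) the curved right-hand side through the target chart
  have hgm : Measurable fun y => ENNReal.ofReal (I (ΛY y) / JY (ΛY y)) :=
    ((hIm.comp hΛYm).div (hJYm.comp hΛYm)).ennreal_ofReal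
  have hR : ∫⁻ y in B, ENNReal.ofReal (I (ΛY y) / JY (ΛY y)) ∂μG = ∫⁻ u in A, ENNReal.ofReal (I u) ∂μY := by
    calc ∫⁻ y in B, ENNReal.ofReal (I (ΛY y) / JY (ΛY y)) ∂μG
        = ∫⁻ y in B, ENNReal.ofReal (I (ΛY y) / JY (ΛY y)) ∂(μG.restrict (ΘY '' S)) := by
          rw [Measure.restrict_restrict hB, inter_eq_left.2 hBS]
      _ = ∫⁻ y in B, ENNReal.ofReal (I (ΛY y) / JY (ΛY y))
            ∂(((μY.restrict S).withDensity fun u => ENNReal.ofReal (JY u)).map ΘY) := by rw [hcovY]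
      _ = ∫⁻ u in ΘY ⁻¹' B, ENNReal.ofReal (I (ΛY (ΘY u)) / JY (ΛY (ΘY u)))
            ∂((μY.restrict S).withDensity fun u => ENNReal.ofReal (JY u)) := setLIntegral_map hB hgm hΘYm
      _ = ∫⁻ u in ΘY ⁻¹' B, ((fun u => ENNReal.ofReal (JY u)) * fun u =>
            ENNReal.ofReal (I (ΛY (ΘY u)) / JY (ΛY (ΘY u)))) u ∂(μY.restrict S) :=
          setLIntegral_withDensity_eq_setLIntegral_mul _ hJYm.ennreal_ofReal (hgm.comp hΘYm) (hΘYm hB)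
      _ = ∫⁻ u in A, ((fun u => ENNReal.ofReal (JY u)) * fun u =>
            ENNReal.ofReal (I (ΛY (ΘY u)) / JY (ΛY (ΘY u)))) u ∂μY := by
          rw [Measure.restrict_restrict (hΘYm hB)]
      _ = ∫⁻ u in A, ENNReal.ofReal (I u) ∂μY := by
          refine setLIntegral_congr_fun hAm fun u hu => ?_
          simp only [Pi.mul_apply]
          rw [hΛΘ u hu.2, ← ENNReal.ofReal_mul (hJY0 u), mul_comm, div_mul_cancel₀ _ (hJYpos u hu.2).ne']
  -- assemble
  rw [hL, hLF, ← hF, hIA A hAm hAD, hR]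


/-! ## §3 (v1.1, append-only) The transport with the flat face in SHARP form -/

/-- ★★★ **CHART TRANSPORT OF THE LOCAL JACOBIAN FACE, SHARP-FORM FLAT INPUT (v1.1).**  As `localFace_of_chartRead`, but the flat face
of the chart-read map at `e₀` is assumed only in the SHARP form — asked of the densities `r̃` vanishing off `O` that are continuous at EVERY
point `e` of `E` with `e ∈ O → Q (ΘX e)` (not merely inside `O`).  This hypothesis is WEAKER than the engine form (so the theorem is
stronger) and, unlike the engine form, it is MONOTONE under cutting the window down and strengthening the exemption off the cut
(`HaarExpChartLocalFaceTransport` v1.1 `sharpFlatFace_cut`) — which is what a producer needs at a configuration where some but not all sharp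
thresholds are inactive.  Same conclusion: the SHARP-form face of `M` at `a = ΘX e₀` w.r.t. `ν`, `μG`.
[cite: HormanderALPDO1, §6.1, proof of Thm 6.1.2 (local coordinates in which the submersion is read; bookkeeping)] -/
theorem localFace_of_chartRead' (μE : Measure E) (μY : Measure Y) (ν : Measure X) (μG : Measure G)
    -- source chart
    {ΘX : E → X} (hΘXm : Measurable ΘX) {T T₀ : Set E} (hT : IsOpen T) (hT₀ : IsOpen T₀) (hT₀T : closure T₀ ⊆ T)
    (hΘXc : ContinuousOn ΘX T) (hΘXi : InjOn ΘX T) (hΘXo : ∀ V : Set E, V ⊆ T → IsOpen V → IsOpen (ΘX '' V))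
    {JX : E → ℝ} (hJXm : Measurable JX) (hJXc : ContinuousOn JX T) (hJX0 : ∀ e, 0 ≤ JX e)
    (hJXC : ∃ C : ℝ, ∀ e ∈ T, JX e ≤ C)
    (hcovX : ν.restrict (ΘX '' T) = ((μE.restrict T).withDensity fun e => ENNReal.ofReal (JX e)).map ΘX)
    -- target chart
    {ΘY : Y → G} (hΘYm : Measurable ΘY) {S : Set Y} (hS : IsOpen S) (hΘYi : InjOn ΘY S)
    (hΘYo : ∀ V : Set Y, V ⊆ S → IsOpen V → IsOpen (ΘY '' V)) {ΛY : G → Y} (hΛYm : Measurable ΛY)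
    (hΛYc : ContinuousOn ΛY (ΘY '' S)) (hΛΘ : ∀ u ∈ S, ΛY (ΘY u) = u)
    {JY : Y → ℝ} (hJYm : Measurable JY) (hJYc : ContinuousOn JY S) (hJY0 : ∀ u, 0 ≤ JY u)
    (hJYpos : ∀ u ∈ S, 0 < JY u)
    (hcovY : μG.restrict (ΘY '' S) = ((μY.restrict S).withDensity fun u => ENNReal.ofReal (JY u)).map ΘY)
    -- the map, the base point, chart-readability
    {M : X → G} (hMm : Measurable M) {e₀ : E} (he₀ : e₀ ∈ T₀) {a : X} (ha : ΘX e₀ = a) (hMc : ContinuousAt M a)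
    (hread : ∀ e ∈ T₀, M (ΘX e) ∈ ΘY '' S) (Q : X → Prop)
    -- the flat local face of the chart-read map at `e₀` (SHARP form)
    (hflat : ∃ O : Set E, ∃ D : Set Y, IsOpen O ∧ e₀ ∈ O ∧ IsOpen D ∧ ΛY (M (ΘX e₀)) ∈ D ∧
      ∀ r : E → ℝ, Measurable r → (∀ e, 0 ≤ r e) → (∀ e, (e ∈ O → Q (ΘX e)) → ContinuousAt r e) →
        (∃ C : ℝ, ∀ e, r e ≤ C) → (∀ e, e ∉ O → r e = 0) →
        ∃ I : Y → ℝ, ContinuousOn I D ∧ (∀ w, 0 ≤ I w) ∧ ∀ A : Set Y, MeasurableSet A → A ⊆ D →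
          (μE.withDensity fun e => ENNReal.ofReal (r e)) ((fun e => ΛY (M (ΘX e))) ⁻¹' A) =
            ∫⁻ w in A, ENNReal.ofReal (I w) ∂μY) :
    ∃ W : Set X, ∃ DG : Set G, ContinuousAt M a ∧ IsOpen W ∧ a ∈ W ∧ IsOpen DG ∧ M a ∈ DG ∧
      ∀ r : X → ℝ, Measurable r → (∀ x, 0 ≤ r x) → (∀ x, (x ∈ W → Q x) → ContinuousAt r x) →
        (∃ C : ℝ, ∀ x, r x ≤ C) → (∀ x, x ∉ W → r x = 0) →
        ∃ I : G → ℝ, ContinuousOn I DG ∧ (∀ y, 0 ≤ I y) ∧ ∀ B : Set G, MeasurableSet B → B ⊆ DG →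
          (ν.withDensity fun x => ENNReal.ofReal (r x)) (M ⁻¹' B) = ∫⁻ y in B, ENNReal.ofReal (I y) ∂μG := by
  subst ha
  obtain ⟨O, D, hO, he₀O, hD, hm₀D, hH⟩ := hflat
  have hT₀T' : T₀ ⊆ T := subset_closure.trans hT₀T
  have hWT : ΘX '' (O ∩ T₀) ⊆ ΘX '' T := image_mono (inter_subset_right.trans hT₀T')
  -- `M a` lies in the target window
  have hMa : M (ΘX e₀) ∈ ΘY '' (D ∩ S) := by
    obtain ⟨u, huS, hu⟩ := hread e₀ he₀
    refine ⟨u, ⟨?_, huS⟩, hu⟩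
    have h1 : ΛY (M (ΘX e₀)) = u := by rw [← hu, hΛΘ u huS]
    rw [← h1]
    exact hm₀D
  refine ⟨ΘX '' (O ∩ T₀), ΘY '' (D ∩ S), hMc, hΘXo _ (inter_subset_right.trans hT₀T') (hO.inter hT₀),
    ⟨e₀, ⟨he₀O, he₀⟩, rfl⟩, hΘYo _ inter_subset_right (hD.inter hS), hMa, ?_⟩
  intro r hrm hr0 hrc hrC hrW
  -- where `r ∘ ΘX` does not vanish on `T`
  have hkey : ∀ e ∈ T, r (ΘX e) ≠ 0 → e ∈ O ∩ T₀ := by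
    intro e he hne
    by_contra hcon
    apply hne
    apply hrW
    rintro ⟨e', he', hee'⟩
    have h1 : e' = e := hΘXi (hT₀T' he'.2) he hee'
    exact hcon (h1 ▸ he')
  -- the pulled-back density `r̃ = 𝟙_T · (r ∘ ΘX) · JX`
  set rt : E → ℝ := T.indicator fun e => r (ΘX e) * JX e with hrt
  have hrtm : Measurable rt := ((hrm.comp hΘXm).mul hJXm).indicator hT.measurableSet
  have hrt0 : ∀ e, 0 ≤ rt e := fun e => indicator_nonneg (fun e _ => mul_nonneg (hr0 _) (hJX0 e)) e
  obtain ⟨C, hC⟩ := hrC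
  obtain ⟨CJ, hCJ⟩ := hJXC
  have hC0 : 0 ≤ C := (hr0 (ΘX e₀)).trans (hC _)
  have hCJ0 : 0 ≤ CJ := (hJX0 e₀).trans (hCJ e₀ (hT₀T' he₀))
  have hrtC : ∃ C' : ℝ, ∀ e, rt e ≤ C' := by
    refine ⟨C * CJ, fun e => ?_⟩
    by_cases he : e ∈ T
    · rw [hrt, indicator_of_mem he]
      exact mul_le_mul (hC _) (hCJ e he) (hJX0 e) hC0
    · rw [hrt, indicator_of_notMem he]
      exact mul_nonneg hC0 hCJ0
  have hrtO : ∀ e, e ∉ O → rt e = 0 := by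
    intro e heO
    by_cases he : e ∈ T
    · rw [hrt, indicator_of_mem he]
      have h1 : r (ΘX e) = 0 := by
        by_contra hne
        exact heO (hkey e he hne).1
      simp [h1]
    · exact indicator_of_notMem he _
  have hrt_far : ∀ e, e ∉ T → rt =ᶠ[𝓝 e] fun _ => (0 : ℝ) := by
    intro e he
    have he' : e ∉ closure T₀ := fun h => he (hT₀T h)
    filter_upwards [isClosed_closure.isOpen_compl.mem_nhds he'] with e'' he''
    by_cases he''T : e'' ∈ T
    · rw [hrt, indicator_of_mem he''T]
      have h1 : r (ΘX e'') = 0 := by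
        by_contra hne
        exact he'' (subset_closure (hkey e'' he''T hne).2)
      simp [h1]
    · exact indicator_of_notMem he''T _
  have hrtc : ∀ e, (e ∈ O → Q (ΘX e)) → ContinuousAt rt e := by
    intro e hQ
    by_cases he : e ∈ T
    · have h1 : rt =ᶠ[𝓝 e] fun e => r (ΘX e) * JX e := by
        filter_upwards [hT.mem_nhds he] with e' he' using indicator_of_mem he' _
      refine (continuousAt_congr h1).2 ?_
      have hrx : ContinuousAt r (ΘX e) := by
        refine hrc _ fun hxW => hQ ?_
        obtain ⟨e', he', hee'⟩ := hxW
        have h2 : e' = e := hΘXi (hT₀T' he'.2) he hee'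
        exact h2 ▸ he'.1
      have h2 : ContinuousAt (fun e => r (ΘX e)) e := hrx.comp (hΘXc.continuousAt (hT.mem_nhds he))
      exact h2.mul (hJXc.continuousAt (hT.mem_nhds he))
    · exact (continuousAt_congr (hrt_far e he)).2 continuousAt_const
  -- the flat face, with the density upgraded to a measurable one
  obtain ⟨I₀, hI₀c, hI₀0, hI₀A⟩ := hH rt hrtm hrt0 hrtc hrtC hrtO
  set I : Y → ℝ := D.indicator I₀ with hI
  have hIm : Measurable I := measurable_indicator_of_continuousOn hD.measurableSet hI₀c
  have hIc : ContinuousOn I D := hI₀c.congr fun u hu => indicator_of_mem hu _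
  have hI0 : ∀ u, 0 ≤ I u := fun u => indicator_nonneg (fun u _ => hI₀0 u) u
  have hIA : ∀ A : Set Y, MeasurableSet A → A ⊆ D →
      (μE.withDensity fun e => ENNReal.ofReal (rt e)) ((fun e => ΛY (M (ΘX e))) ⁻¹' A) =
        ∫⁻ w in A, ENNReal.ofReal (I w) ∂μY := by
    intro A hA hAD
    rw [hI₀A A hA hAD]
    exact setLIntegral_congr_fun hA fun w hw => by rw [hI, indicator_of_mem (hAD hw)]
  -- the transported density
  refine ⟨fun y => I (ΛY y) / JY (ΛY y), ?_, fun y => div_nonneg (hI0 _) (hJY0 _), fun B hB hBsub => ?_⟩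
  · -- continuity on `ΘY '' (D ∩ S)`
    have hmaps : MapsTo ΛY (ΘY '' (D ∩ S)) (D ∩ S) := by
      rintro _ ⟨u, hu, rfl⟩
      rw [hΛΘ u hu.2]
      exact hu
    have hΛc : ContinuousOn ΛY (ΘY '' (D ∩ S)) := hΛYc.mono (image_mono inter_subset_right)
    exact ((hIc.mono inter_subset_left).comp hΛc hmaps).div ((hJYc.mono inter_subset_right).comp hΛc hmaps)
      fun y hy => (hJYpos _ (hmaps hy).2).ne'
  -- the identity above `B ⊆ ΘY '' (D ∩ S)`
  have hBS : B ⊆ ΘY '' S := hBsub.trans (image_mono inter_subset_right)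
  set A : Set Y := ΘY ⁻¹' B ∩ S with hAdef
  have hAm : MeasurableSet A := (hΘYm hB).inter hS.measurableSet
  have hAD : A ⊆ D := by
    rintro u ⟨huB, huS⟩
    obtain ⟨u', hu', he⟩ := hBsub huB
    rw [← hΘYi hu'.2 huS he]
    exact hu'.1
  have hTm' : MeasurableSet (ΘX '' T) := (hΘXo T Subset.rfl hT).measurableSet
  -- (1) the curved left-hand side through the source chart
  have hL : (ν.withDensity fun x => ENNReal.ofReal (r x)) (M ⁻¹' B) =
      ∫⁻ e in (fun e => M (ΘX e)) ⁻¹' B ∩ T, ENNReal.ofReal (JX e) * ENNReal.ofReal (r (ΘX e)) ∂μE := by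
    rw [withDensity_apply _ (hMm hB), ← lintegral_inter_add_sdiff _ (M ⁻¹' B) hTm']
    have hz : ∫⁻ x in M ⁻¹' B \ ΘX '' T, ENNReal.ofReal (r x) ∂ν = 0 := by
      have h1 : EqOn (fun x => ENNReal.ofReal (r x)) (fun _ => 0) (M ⁻¹' B \ ΘX '' T) := by
        intro x hx
        have : r x = 0 := hrW x fun h => hx.2 (hWT h)
        simp [this]
      rw [setLIntegral_congr_fun ((hMm hB).diff hTm') h1, lintegral_zero]
    have hm1 : Measurable fun x => ENNReal.ofReal (r (ΘX x)) := (hrm.comp hΘXm).ennreal_ofReal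
    rw [hz, add_zero, ← Measure.restrict_restrict (hMm hB), hcovX, setLIntegral_map (hMm hB) hrm.ennreal_ofReal hΘXm,
      setLIntegral_withDensity_eq_setLIntegral_mul _ hJXm.ennreal_ofReal hm1 (hΘXm (hMm hB)),
      Measure.restrict_restrict (hΘXm (hMm hB))]
    rfl
  -- (2) the flat left-hand side
  have hpre : MeasurableSet ((fun e => ΛY (M (ΘX e))) ⁻¹' A) := (hΛYm.comp (hMm.comp hΘXm)) hAm
  have hF : (μE.withDensity fun e => ENNReal.ofReal (rt e)) ((fun e => ΛY (M (ΘX e))) ⁻¹' A) =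
      ∫⁻ e in (fun e => ΛY (M (ΘX e))) ⁻¹' A ∩ T, ENNReal.ofReal (JX e) * ENNReal.ofReal (r (ΘX e)) ∂μE := by
    rw [withDensity_apply _ hpre, ← lintegral_inter_add_sdiff _ _ hT.measurableSet]
    have hz : ∫⁻ e in (fun e => ΛY (M (ΘX e))) ⁻¹' A \ T, ENNReal.ofReal (rt e) ∂μE = 0 := by
      have h1 : EqOn (fun e => ENNReal.ofReal (rt e)) (fun _ => 0) ((fun e => ΛY (M (ΘX e))) ⁻¹' A \ T) := by
        intro e he
        simp [hrt, indicator_of_notMem he.2]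
      rw [setLIntegral_congr_fun (hpre.diff hT.measurableSet) h1, lintegral_zero]
    rw [hz, add_zero]
    refine setLIntegral_congr_fun (hpre.inter hT.measurableSet) fun e he => ?_
    simp only [hrt, indicator_of_mem he.2]
    rw [ENNReal.ofReal_mul (hr0 _), mul_comm]
  -- (3) the two flat integrals agree: on `T`, where `r ∘ ΘX ≠ 0`, membership in the two sets coincides
  have hLF : ∫⁻ e in (fun e => M (ΘX e)) ⁻¹' B ∩ T, ENNReal.ofReal (JX e) * ENNReal.ofReal (r (ΘX e)) ∂μE =
      ∫⁻ e in (fun e => ΛY (M (ΘX e))) ⁻¹' A ∩ T, ENNReal.ofReal (JX e) * ENNReal.ofReal (r (ΘX e)) ∂μE := by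
    have hPm : MeasurableSet ((fun e => M (ΘX e)) ⁻¹' B) := (hMm.comp hΘXm) hB
    rw [← Measure.restrict_restrict hPm, ← Measure.restrict_restrict hpre, ← lintegral_indicator hPm,
      ← lintegral_indicator hpre]
    refine setLIntegral_congr_fun hT.measurableSet fun e he => ?_
    by_cases hre : r (ΘX e) = 0
    · have h1 : ∀ P₁ : Set E, P₁.indicator (fun e => ENNReal.ofReal (JX e) * ENNReal.ofReal (r (ΘX e))) e = 0 := by
        intro P₁
        by_cases hP₁ : e ∈ P₁
        · rw [indicator_of_mem hP₁, hre, ENNReal.ofReal_zero, mul_zero]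
        · rw [indicator_of_notMem hP₁]
      rw [h1, h1]
    · obtain ⟨u', hu'S, hu'⟩ := hread e (hkey e he hre).2
      have hiff : e ∈ (fun e => M (ΘX e)) ⁻¹' B ↔ e ∈ (fun e => ΛY (M (ΘX e))) ⁻¹' A := by
        simp only [mem_preimage, hAdef, mem_inter_iff]
        rw [← hu', hΛΘ u' hu'S]
        exact ⟨fun h => ⟨h, hu'S⟩, fun h => h.1⟩
      by_cases hP : e ∈ (fun e => M (ΘX e)) ⁻¹' B
      · rw [indicator_of_mem hP, indicator_of_mem (hiff.1 hP)]
      · rw [indicator_of_notMem hP, indicator_of_notMem (fun h => hP (hiff.2 h))]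
  -- (4) the curved right-hand side through the target chart
  have hgm : Measurable fun y => ENNReal.ofReal (I (ΛY y) / JY (ΛY y)) :=
    ((hIm.comp hΛYm).div (hJYm.comp hΛYm)).ennreal_ofReal
  have hR : ∫⁻ y in B, ENNReal.ofReal (I (ΛY y) / JY (ΛY y)) ∂μG = ∫⁻ u in A, ENNReal.ofReal (I u) ∂μY := by
    calc ∫⁻ y in B, ENNReal.ofReal (I (ΛY y) / JY (ΛY y)) ∂μG
        = ∫⁻ y in B, ENNReal.ofReal (I (ΛY y) / JY (ΛY y)) ∂(μG.restrict (ΘY '' S)) := by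
          rw [Measure.restrict_restrict hB, inter_eq_left.2 hBS]
      _ = ∫⁻ y in B, ENNReal.ofReal (I (ΛY y) / JY (ΛY y))
            ∂(((μY.restrict S).withDensity fun u => ENNReal.ofReal (JY u)).map ΘY) := by rw [hcovY]
      _ = ∫⁻ u in ΘY ⁻¹' B, ENNReal.ofReal (I (ΛY (ΘY u)) / JY (ΛY (ΘY u)))
            ∂((μY.restrict S).withDensity fun u => ENNReal.ofReal (JY u)) := setLIntegral_map hB hgm hΘYm
      _ = ∫⁻ u in ΘY ⁻¹' B, ((fun u => ENNReal.ofReal (JY u)) * fun u =>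
            ENNReal.ofReal (I (ΛY (ΘY u)) / JY (ΛY (ΘY u)))) u ∂(μY.restrict S) :=
          setLIntegral_withDensity_eq_setLIntegral_mul _ hJYm.ennreal_ofReal (hgm.comp hΘYm) (hΘYm hB)
      _ = ∫⁻ u in A, ((fun u => ENNReal.ofReal (JY u)) * fun u =>
            ENNReal.ofReal (I (ΛY (ΘY u)) / JY (ΛY (ΘY u)))) u ∂μY := by
          rw [Measure.restrict_restrict (hΘYm hB)]
      _ = ∫⁻ u in A, ENNReal.ofReal (I u) ∂μY := by
          refine setLIntegral_congr_fun hAm fun u hu => ?_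
          simp only [Pi.mul_apply]
          rw [hΛΘ u hu.2, ← ENNReal.ofReal_mul (hJY0 u), mul_comm, div_mul_cancel₀ _ (hJYpos u hu.2).ne']
  -- assemble
  rw [hL, hLF, ← hF, hIA A hAm hAD, hR]

end Transport

end Literature.MeasureTheory.Integral.PushforwardDensityChartTransport

end
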